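import Literature.AlgebraicGeometry.ShimuraVarieties.UnitaryShimuraCanonicalModel
import HarnessLib

/-!
# Non-vacuity of the reciprocity clause (F3) of the canonical-model record: the CM point and the twist are
# unique, and the Artin correspondence is inhabited

Sibling of `UnitaryShimuraCanonicalModel` (htheta-x1): the record field `Record.recip` quantifies over
`σ`, finite idèles `s` with `IsArtinCorrespondent L τ s σ`, `L`-vectors `v₃`, ball points `x` with
`IsLinePoint L τ T v₃ x`, and twists `d` with `IsDiagTwist L H v₃ (recipFactor L s) d`.  The file
`UnitaryShimuraCanonicalModel` proves (§7) that the twist EXISTS in `U(H)(𝔸_{L⁺,f})`.  Here: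

* `isArtinCorrespondent_one_one` — the pair `(σ, s) = (1, 1)` is Artin-correspondent (so the clause is
  never vacuous: at it, it reads `[x, aK] = [x, 1·aK]`);
* `exists_unique_isLinePoint` — for `v₃` NEGATIVE at `τ` (i.e. `τ(v₃)` in the negative cone of `H^τ`) there
  is EXACTLY ONE ball point `x` on the line `ℂ·τ(v₃)` through the frame `T` (`x = proj (T⁻¹ τ(v₃))`), and
  for `v₃` not negative there is none (`not_isLinePoint_of_not_mem_negCone`) — the CM point of the diagonal
  special pair `(T₃, x)` ([Milne 2005] Def. 12.5, Rem. 12.6);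
* `isDiagTwist_unique` — for `v₃` anisotropic (`⟨v₃, v₃⟩_H ≠ 0`) the twist `d` with eigenvalue `t` on `v₃`
  fixing `v₃^{⊥}` is UNIQUE in `U(H)(𝔸_{L⁺,f})` (`L³ = L·v₃ ⊕ v₃^{⊥}`), so the `∀ d, IsDiagTwist … →` of the
  record speaks about the one element `diag_b(1,1,t)` of [Milne 2005] (62).

THEOREMS ONLY; no definition, no named fact.  (Cells pub-hodgecm / pub-hodgecm2: vacuity pass of the S2
canonical-model record, binder-2 g24.)

## References
* [Milne2005ShimuraVarieties] J. S. Milne, *Introduction to Shimura varieties* (2005), Def. 12.5, Rem. 12.6,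
  Def. 12.8 (62).
* [Deligne1979ShimuraVarieties] P. Deligne, *Variétés de Shimura* (1979), 2.2.4.
-/

set_option autoImplicit false

noncomputable section

open Function MulAction Topology NumberField IsDedekindDomain Matrix
open scoped Matrix ComplexOrder
open Literature.NumberTheory.Automorphic Literature.NumberTheory.Automorphic.UnitaryGroup
open Literature.NumberTheory.GaloisRepresentations
open Literature.Geometry.ComplexHyperbolic Literature.Geometry.ComplexHyperbolic.BallModel

namespace Literature.AlgebraicGeometry.ShimuraVarieties

namespace UnitaryCanonicalModel

variable (L : Type) [Field L] [NumberField L] [IsCMField L]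

/-! ### §1. The Artin correspondence is inhabited: `(σ, s) = (1, 1)` -/

omit [IsCMField L] in
/-- **`(σ, s) = (id, 1)` is an Artin-correspondent pair**: along any `L`-embedding `e : L̄ → ℂ`
(one exists, `ℂ` being algebraically closed) the identity of `ℂ` restricts to `γ = 1 ∈ Gal(L̄/L)`, whose
class is `θ_L(1)⁻¹ = 1` ([Milne 2005] (59): `art(1) = 1`).  Hence the reciprocity clause (62) of the
record is never vacuous. [cite: Milne2005ShimuraVarieties, (59) p. 107 and Def. 12.8 (62) p. 114] -/
theorem isArtinCorrespondent_one_one (τ : L →+* ℂ) :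
    IsArtinCorrespondent L τ 1 (RingEquiv.refl ℂ) := by
  letI : Algebra L ℂ := τ.toAlgebra
  refine ⟨IsAlgClosed.lift (R := L) (M := ℂ) (S := AlgebraicClosure L), 1, fun x => ?_, ?_⟩
  · simp [Field.absoluteGaloisGroup.toAlgEquiv]
  · have h1 : finiteIdeleClass L 1 = 1 := by
      unfold finiteIdeleClass
      rw [map_one]
      rfl
    rw [h1, map_one, map_one, inv_one]

/-! ### §2. The CM point of a negative `L`-line: existence and uniqueness -/

variable (H : Matrix (Fin 3) (Fin 3) L) (τ : L →+* ℂ) (T : GL (Fin 3) ℂ)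

omit [Field L] [NumberField L] [IsCMField L] in
/-- `lift (proj w) = w₂⁻¹ • w` (re-proved; the tree's lemma of this name lives in the namespace of
`UnitaryBallUniformisationDatum`). [folklore] -/
private theorem lift_proj' {w : Fin 3 → ℂ} (hw : Q w < 0) :
    BallModel.lift (proj w hw) = (w 2)⁻¹ • w := by
  have h2 := BallModel.ne_zero_of_Q_neg hw
  funext k
  fin_cases k
  · simp [BallModel.lift, div_eq_inv_mul]
  · simp [BallModel.lift, div_eq_inv_mul]
  · simp [BallModel.lift, h2]

omit [NumberField L] [IsCMField L] in
/-- In the frame `T` (`Tᴴ H^τ T = J`) the hermitian square of `T w` is `Q(w)`. [folklore] -/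
private theorem hermForm_frame_apply (hT : formCongr (starRingEnd ℂ) T (H.map τ) = BallModel.J)
    (w : Fin 3 → ℂ) :
    hermForm (starRingEnd ℂ) (H.map τ) ((T : Matrix (Fin 3) (Fin 3) ℂ) *ᵥ w)
        ((T : Matrix (Fin 3) (Fin 3) ℂ) *ᵥ w) = ((Q w : ℝ) : ℂ) := by
  rw [hermForm_starRingEnd, ← form_eq_Q, ← hT, star_mulVec, ← dotProduct_mulVec, mulVec_mulVec,
    mulVec_mulVec]
  rfl

omit [NumberField L] [IsCMField L] in
/-- **No CM point off the negative cone**: if `τ(v₃)` is not a negative vector of `H^τ`, no ball point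
lies on the line `ℂ · τ(v₃)` (the lift of a ball point is `J`-negative, and the frame carries `J`-negative
vectors to negative vectors of `H^τ`). [cite: Milne2005ShimuraVarieties, Def. 12.5 p. 113] -/
theorem not_isLinePoint_of_not_mem_negCone
    (hT : formCongr (starRingEnd ℂ) T (H.map τ) = BallModel.J) (v₃ : Fin 3 → L)
    (hv : (fun i => τ (v₃ i)) ∉ negCone (H.map τ)) (x : Ball) : ¬ IsLinePoint L τ T v₃ x := by
  rintro ⟨c, hc, hx⟩
  apply hv
  -- `τ(v₃) = c⁻¹ • T (lift x)` is negative
  have hv' : (fun i => τ (v₃ i)) = (T : Matrix (Fin 3) (Fin 3) ℂ) *ᵥ (c⁻¹ • BallModel.lift x) := by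
    rw [mulVec_smul, hx, smul_smul, inv_mul_cancel₀ hc, one_smul]
  rw [hv', mem_negCone_iff, ← hermForm_starRingEnd, hermForm_frame_apply L H τ T hT, Complex.ofReal_re]
  have hQ : Q (c⁻¹ • BallModel.lift x) = ‖c⁻¹‖ ^ 2 * Q (BallModel.lift x) := by
    simp only [Q, Pi.smul_apply, smul_eq_mul, norm_mul]
    ring
  rw [hQ]
  exact mul_neg_of_pos_of_neg (pow_pos (norm_pos_iff.mpr (inv_ne_zero hc)) 2) (Q_lift x)

omit [NumberField L] [IsCMField L] in
/-- **The CM point of a negative `L`-line exists and is unique**: for `v₃ ∈ L³` with `τ(v₃)` in the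
negative cone of `H^τ` there is exactly one `x ∈ 𝔹²` with `T·(x,1) ∈ ℂˣ · τ(v₃)`, namely the projection of
`T⁻¹ τ(v₃)` — the `T₃(ℝ)`-fixed point of the diagonal special pair ([Milne 2005] Def. 12.5, Rem. 12.6).
[cite: Milne2005ShimuraVarieties, Def. 12.5 and Rem. 12.6 p. 113] -/
theorem exists_unique_isLinePoint (hT : formCongr (starRingEnd ℂ) T (H.map τ) = BallModel.J)
    (v₃ : Fin 3 → L) (hv : (fun i => τ (v₃ i)) ∈ negCone (H.map τ)) :
    ∃! x : Ball, IsLinePoint L τ T v₃ x := by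
  set v : Fin 3 → ℂ := fun i => τ (v₃ i) with hv_def
  set w : Fin 3 → ℂ := ((T⁻¹ : GL (Fin 3) ℂ) : Matrix (Fin 3) (Fin 3) ℂ) *ᵥ v with hw_def
  have hTw : (T : Matrix (Fin 3) (Fin 3) ℂ) *ᵥ w = v := by
    rw [hw_def, mulVec_mulVec, ← Units.val_mul, mul_inv_cancel, Units.val_one, one_mulVec]
  -- `w` is `J`-negative
  have hQ : Q w < 0 := by
    have h := hv
    rw [← hTw, mem_negCone_iff, ← hermForm_starRingEnd, hermForm_frame_apply L H τ T hT,
      Complex.ofReal_re] at h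
    exact h
  have h2 := BallModel.ne_zero_of_Q_neg hQ
  refine ⟨proj w hQ, ⟨(w 2)⁻¹, inv_ne_zero h2, ?_⟩, ?_⟩
  · rw [lift_proj' hQ, mulVec_smul, hTw]
  · rintro x ⟨c, hc, hx⟩
    -- `lift x = c • w`, so `c = (w 2)⁻¹` and `x = proj w`
    have hlx : BallModel.lift x = c • w := by
      have := congrArg (fun u => ((T⁻¹ : GL (Fin 3) ℂ) : Matrix (Fin 3) (Fin 3) ℂ) *ᵥ u) hx
      simpa only [mulVec_mulVec, ← Units.val_mul, inv_mul_cancel, Units.val_one, one_mulVec,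
        mulVec_smul] using this
    have hc2 : c * w 2 = 1 := by
      have := congrFun hlx 2
      simpa only [BallModel.lift_2, Pi.smul_apply, smul_eq_mul] using this.symm
    have hc' : c = (w 2)⁻¹ := eq_inv_of_mul_eq_one_left hc2
    apply Ball.ext
    intro i
    have hli : BallModel.lift x (Fin.castSucc i) = x.1 i := by
      fin_cases i <;> rfl
    have hi := congrFun hlx (Fin.castSucc i)
    rw [proj_val, div_eq_inv_mul, ← hc', ← hli, hi, Pi.smul_apply, smul_eq_mul]

/-! ### §3. The diagonal twist is unique -/

/-- `⟨·, v₃⟩_H` is additive in the first variable. [folklore] -/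
private theorem hermForm_sub_left (x y v : Fin 3 → L) :
    hermForm (cmConjRingHom L) H (x - y) v = hermForm (cmConjRingHom L) H x v - hermForm (cmConjRingHom L) H y v := by
  simp only [hermForm, dotProduct, Function.comp_apply, Pi.sub_apply, map_sub, sub_mul,
    Finset.sum_sub_distrib]

/-- `⟨a • x, v⟩_H = c(a) · ⟨x, v⟩_H` (conjugate-linear in the first variable). [folklore] -/
private theorem hermForm_smul_left (a : L) (x v : Fin 3 → L) :
    hermForm (cmConjRingHom L) H (a • x) v = cmConjRingHom L a * hermForm (cmConjRingHom L) H x v := by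
  simp only [hermForm, dotProduct, Function.comp_apply, Pi.smul_apply, smul_eq_mul, map_mul,
    Finset.mul_sum, mul_assoc]

omit [IsCMField L] in
/-- `adelicVec` is additive. [folklore] -/
private theorem adelicVec_sub (x y : Fin 3 → L) : adelicVec L (x - y) = adelicVec L x - adelicVec L y := by
  funext i; simp [adelicVec]

omit [IsCMField L] in
/-- `adelicVec (a • x) = a ⊗ 1 • adelicVec x`. [folklore] -/
private theorem adelicVec_smul (a : L) (x : Fin 3 → L) :
    adelicVec L (a • x) = algebraMap L (FiniteAdeleRing (𝓞 L) L) a • adelicVec L x := by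
  funext i; simp [adelicVec]

omit [IsCMField L] in
/-- `adelicVec (Pi.single j 1) = Pi.single j 1`. [folklore] -/
private theorem adelicVec_single (j : Fin 3) :
    adelicVec L (Pi.single j 1) = Pi.single j 1 := by
  funext i
  by_cases h : i = j
  · subst h; simp [adelicVec]
  · simp [adelicVec, h]

/-- **The diagonal twist is unique**: for `v₃` anisotropic (`⟨v₃, v₃⟩_H ≠ 0`), two elements of
`U(H)(𝔸_{L⁺,f})` multiplying `v₃ ⊗ 1` by `t` and fixing `w ⊗ 1` for every `w ⊥_H v₃` coincide
(`L³ = L·v₃ ⊕ v₃^{⊥_H}` spans `𝔸_{L,f}³`); the record's `∀ d, IsDiagTwist … d → …` is therefore about the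
single element `diag_b(1,1,t) = z_r(τ)` of [Milne 2005] (62) / [Deligne 1979] 2.2.4.
[cite: Milne2005ShimuraVarieties, Def. 12.8 (62) p. 114] [cite: Deligne1979ShimuraVarieties, 2.2.4] -/
theorem isDiagTwist_unique {v₃ : Fin 3 → L} (hv : hermForm (cmConjRingHom L) H v₃ v₃ ≠ 0)
    {t : FiniteAdeleRing (𝓞 L) L}
    {d d' : finAdelic (↥(maximalRealSubfield L)) L (IsCMField.complexConj L) 3 H}
    (hd : IsDiagTwist L H v₃ t d) (hd' : IsDiagTwist L H v₃ t d') : d = d' := by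
  set M : Matrix (Fin 3) (Fin 3) (FiniteAdeleRing (𝓞 L) L) :=
    ((d : GL (Fin 3) (FiniteAdeleRing (𝓞 L) L)) : Matrix (Fin 3) (Fin 3) (FiniteAdeleRing (𝓞 L) L)) with hM
  set M' : Matrix (Fin 3) (Fin 3) (FiniteAdeleRing (𝓞 L) L) :=
    ((d' : GL (Fin 3) (FiniteAdeleRing (𝓞 L) L)) : Matrix (Fin 3) (Fin 3) (FiniteAdeleRing (𝓞 L) L)) with hM'
  -- `M` and `M'` agree on every `y ⊗ 1`, `y ∈ L³`
  have hagree : ∀ y : Fin 3 → L, M *ᵥ adelicVec L y = M' *ᵥ adelicVec L y := by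
    intro y
    -- `y = a • v₃ + w` with `w ⊥ v₃`
    set a : L := cmConjRingHom L (hermForm (cmConjRingHom L) H y v₃ * (hermForm (cmConjRingHom L) H v₃ v₃)⁻¹)
      with ha
    have hcc : ∀ z : L, IsCMField.complexConj L (IsCMField.complexConj L z) = z := fun z => by
      have h2 : IsCMField.complexConj L * IsCMField.complexConj L = 1 := by
        rw [← pow_two, ← IsCMField.orderOf_complexConj L, pow_orderOf_eq_one]
      have := congrArg (fun f : L ≃ₐ[↥(maximalRealSubfield L)] L => f z) h2
      simpa only [AlgEquiv.mul_apply, AlgEquiv.one_apply] using this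
    have hca : cmConjRingHom L a = hermForm (cmConjRingHom L) H y v₃ * (hermForm (cmConjRingHom L) H v₃ v₃)⁻¹ := by
      rw [ha, cmConjRingHom_apply, cmConjRingHom_apply]
      exact hcc _
    have hw : hermForm (cmConjRingHom L) H (y - a • v₃) v₃ = 0 := by
      rw [hermForm_sub_left, hermForm_smul_left, hca, mul_assoc, inv_mul_cancel₀ hv, mul_one, sub_self]
    have hy : adelicVec L y = algebraMap L (FiniteAdeleRing (𝓞 L) L) a • adelicVec L v₃ + adelicVec L (y - a • v₃) := by
      rw [adelicVec_sub, adelicVec_smul, add_sub_cancel]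
    rw [hy, mulVec_add, mulVec_add, mulVec_smul, mulVec_smul, hd.1, hd'.1, hd.2 _ hw, hd'.2 _ hw]
  have hMM : M = M' := by
    refine Matrix.ext fun i j => ?_
    have h := congrFun (hagree (Pi.single j 1)) i
    rw [adelicVec_single, Matrix.mulVec_single_one, Matrix.mulVec_single_one] at h
    simpa only [Matrix.col_apply] using h
  exact Subtype.ext (Units.ext hMM)

end UnitaryCanonicalModel

end Literature.AlgebraicGeometry.ShimuraVarieties

end
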